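import Literature.RepresentationTheory.FiniteGroups.SignedFixedWordsInjective
import Literature.RepresentationTheory.FiniteGroups.SymmetricGroupFrobeniusFormula
import Literature.NumberTheory.DiophantineGeometry.SymmetricGroupRepsKroneckerCharacterProofs
import Literature.NumberTheory.DiophantineGeometry.SymmetricGroupRepsSignTwist
import HarnessLib

/-!
# Kronecker coefficients as signed counts of binary three-dimensional arrays

Topic `Literature/RepresentationTheory/FiniteGroups`. For partitions `λ, μ, ν ⊢ D` with
`ℓ(λᵀ), ℓ(μ), ℓ(ν) ≤ N`, the Kronecker coefficient `g(λ, μ, ν)` (the tree's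
`Literature.NumberTheory.DiophantineGeometry.kroneckerCoeff`) is the SIGNED COUNT OF `0`-`1` ARRAYS
in the cube `[N] × [N] × [N]`:

  `g(λ, μ, ν) = Σ_{τ₁, τ₂, τ₃ ∈ 𝔖_N} sgn(τ₁) sgn(τ₂) sgn(τ₃) ·
      #{S ⊆ [N]³ : #S = D, S has slice margins λᵀ + ρ - τ₁ρ, μ + ρ - τ₂ρ, ν + ρ - τ₃ρ}`

(`kroneckerCoeff_eq_signedBinaryCubeCount`; `ρ = (N-1, …, 0)`, margins written additively as in
the tree's Frobenius formula: `ρ(τ⁻¹ j) + X_j = a_j + ρ_j`). This is the alternant (Weyl /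
Frobenius determinantal) form of Ikenmeyer–Mulmuley–Walter's description of Kronecker coefficients
by point sets in the cube: `k^λ_{μπ}` is the multiplicity of `V_{λᵀ} ⊗ V_{μᵀ} ⊗ V_{πᵀ}` in
`Λ^D(ℂ^N ⊗ ℂ^N ⊗ ℂ^N)` (IMW Lemma 2.1), whose weight multiplicities are the numbers `t` of point sets
with prescribed marginals (IMW Lemma 2.2; Vallejo 2000; Snapper 1971 for the bipartite analogue).

PROOF (symmetric-group side only, all inputs in the tree): `D!·g(λ,μ,ν) = Σ_σ χ^λ(σ)χ^μ(σ)χ^ν(σ)`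
(`kroneckerCoeff_eq_sum_spechtCharacter_holds`), `χ^λ = sgn · χ^{λᵀ}` (`spechtCharacter_transpose`,
`Nat.Partition.transpose_transpose`), Frobenius's formula in permutation-module form
`χ^α(σ) = Σ_τ sgn τ · #{w : [D] → [N] | w∘σ = w, cont w = α + ρ - τρ}`
(`spechtCharacter_eq_sum_sign_mul_card`), the sign-weighted fixed-word lemma
`Σ_σ sgn σ · #Fix_A(σ) #Fix_B(σ) #Fix_C(σ) = #{injective triples}`
(`sum_sign_mul_card_fixed_eq_card_injective`, brick P1), and the count
`#{f : [D] ↪ X with P(image f)} = D! · #{S ⊆ X : #S = D, P S}`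
(`card_filter_injective_eq_factorial_mul_card`, this file).

Also here (pure finite combinatorics, used for the rectangular Kronecker coefficients `k_m(δ)` of
Bürgisser–Ikenmeyer 2017 §5): COMPLEMENTATION IN THE CUBE. For constant margins `m` and `m'` with
`m + m' = N²`, `S ↦ [N]³ ∖ S` (followed by relabelling the axes by `τᵢ`) is a bijection between the
arrays counted at `(τ₁, τ₂, τ₃; m; D = mN)` and at `(τ₁⁻¹, τ₂⁻¹, τ₃⁻¹; m'; D' = m'N)`, whence
`signedBinaryCubeCount N (mN) m m m = signedBinaryCubeCount N (m'N) m' m' m'`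
(`signedBinaryCubeCount_const_eq_of_add_eq_sq`) — the combinatorial shadow of
`Λ^D(W) ≅ Λ^{dim W - D}(W)^* ⊗ det W` for `W = ℂ^N ⊗ ℂ^N ⊗ ℂ^N`.

Also (§5, appended): the BOX complement for GENERAL margins `a_j + a'_{w₀ j} = N²` (reverse the
three axes, reindex by `τ ↦ w₀τw₀`): `signedBinaryCubeCount_eq_compl_rev` — the combinatorial form
of the relation `k(λ,μ,ν) = k(n²×n - λ, n²×n - μ, n²×n - ν)` of Ikenmeyer's thesis quoted in the
proof of BI 2017 Thm. 5.9 (3). IN PRINT (located by val-lit-t08 g6 after §4–§5 landed): the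
rectangular case is Li–Zhang–Xia 2021 Thm. 3.1 (`k_{n²-j}(n) = k_j(n)`, from Ikenmeyer 2012, their
eq. (3.1)) and Amanov–Yeliussizov 2022 Thm. 5.1 (ii) (`g_d(n,k) = g_d(k^{d-1}-n,k)`, odd `d`); the
alternant identity of §3 and the proofs here are independent of those sources.

Honest framing: classical character theory of `𝔖_D`; bookkeeping towards typed-literature values
(BI 2017 Ex. 5.6 / Rem. 5.18); nothing here bears on VP versus VNP.

## References
* [IkenmeyerMulmuleyWalter2017] C. Ikenmeyer, K. D. Mulmuley, M. Walter, *On vanishing of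
  Kronecker coefficients*, Comput. Complexity 26 (2017), Lemma 2.1, Lemma 2.2, Lemma 2.3 (arXiv p. 7).
* [FultonHarrisGTM129] W. Fulton, J. Harris, GTM 129, (4.41) and Exercise 4.51.
* [JamesKerber1981] G. James, A. Kerber, Encyclopedia Math. Appl. 16, 1.3.13, 2.3.15.
* E. Vallejo, *Plane partitions and characters of the symmetric group*, J. Algebraic Combin. 11
  (2000) 79–88; E. Snapper, J. Algebra 19 (1971) 520–535.
* [LiZhangXia2021] X. Li, L. Zhang, H. Xia, arXiv:2111.07343, Thm. 3.1 and eq. (3.1) (box complement).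
* [AmanovYeliussizov2022] A. Amanov, D. Yeliussizov, IMRN 2023 = arXiv:2202.11059, Thm. 5.1 (ii).

## Mathlib and tree
Tree: `kroneckerCoeff`, `spechtCharacter`, `kroneckerCoeff_eq_sum_spechtCharacter_holds`
(`SymmetricGroupReps*`), `spechtCharacter_transpose`, `Nat.Partition.transpose(_transpose)`
(`SymmetricGroupRepsSignTwist`, `PartitionTableaux`), `spechtCharacter_eq_sum_sign_mul_card`, `rho`,
`Word`, `wordContent` (`SymmetricGroupFrobeniusFormula`, `SchurPolynomials`, `TensorWordModel`),
`sum_sign_mul_card_fixed_eq_card_injective` (`SignedFixedWordsInjective`). Mathlib: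
`Fintype.card_embedding_eq`, `Finset.card_eq_sum_card_fiberwise`, `Finset.card_compl`.

Provenance: val-lit cell, prover val-lit-p4 g6 (E1 δ = 4 block, lead-bip RULINGS #33).
-/

namespace Literature.RepresentationTheory.FiniteGroups

open Finset
open Literature.RingTheory.SymmetricFunctions.SymmPoly (rho rho_apply)
open Literature.NumberTheory.DiophantineGeometry (Word wordContent kroneckerCoeff spechtCharacter
  spechtCharacter_transpose kroneckerCoeff_eq_sum_spechtCharacter_holds)

/-! ### 1. Injective maps with a prescribed property of the image -/

section Injective

variable {D : ℕ} {X : Type*} [Fintype X] [DecidableEq X]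

/-- For a finite set `S`, the injective maps `[D] → X` with image exactly `S` number `D!` if
`#S = D` (the bijections `[D] → S`) and `0` otherwise. [cite: JamesKerber1981, 1.3.13] -/
theorem card_filter_injective_image_eq (S : Finset X) :
    ((univ : Finset (Fin D → X)).filter
        fun f => Function.Injective f ∧ univ.image f = S).card =
      if S.card = D then D.factorial else 0 := by
  classical
  split_ifs with hS
  · have hset : ((univ : Finset (Fin D → X)).filter
          fun f => Function.Injective f ∧ univ.image f = S) =
        (univ.filter fun f : Fin D → X => Function.Injective f ∧ ∀ p, f p ∈ S) := by
      refine Finset.filter_congr fun f _ => ?_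
      constructor
      · rintro ⟨hf, hS'⟩
        exact ⟨hf, fun p => hS' ▸ mem_image_of_mem f (mem_univ p)⟩
      · rintro ⟨hf, hmem⟩
        refine ⟨hf, Finset.eq_of_subset_of_card_le (fun x hx => ?_) ?_⟩
        · obtain ⟨p, -, rfl⟩ := mem_image.mp hx
          exact hmem p
        · rw [hS, Finset.card_image_of_injective _ hf, card_univ, Fintype.card_fin]
    rw [hset]
    have hcard : Fintype.card {f : Fin D → X // Function.Injective f ∧ ∀ p, f p ∈ S} =
        Fintype.card (Fin D ↪ S) :=
      Fintype.card_congr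
        { toFun := fun f => ⟨fun p => ⟨f.1 p, f.2.2 p⟩,
            fun p q h => f.2.1 (congrArg Subtype.val h)⟩
          invFun := fun e => ⟨fun p => (e p : X), Subtype.val_injective.comp e.injective,
            fun p => (e p).2⟩
          left_inv := fun _ => rfl
          right_inv := fun _ => rfl }
    calc (univ.filter fun f : Fin D → X => Function.Injective f ∧ ∀ p, f p ∈ S).card
        = Fintype.card {f : Fin D → X // Function.Injective f ∧ ∀ p, f p ∈ S} :=
          (Fintype.card_subtype _).symm
      _ = Fintype.card (Fin D ↪ S) := hcard
      _ = D.factorial := by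
          rw [Fintype.card_embedding_eq, Fintype.card_coe, hS, Fintype.card_fin,
            Nat.descFactorial_self]
  · rw [Finset.card_eq_zero, Finset.filter_eq_empty_iff]
    rintro f - ⟨hf, rfl⟩
    exact hS (by rw [Finset.card_image_of_injective _ hf, card_univ, Fintype.card_fin])

/-- **Injective maps versus subsets**: the injective maps `f : [D] → X` whose image has a property
`P` number `D!` times the `D`-subsets of `X` with property `P` (each such subset is the image of
exactly `D!` injective maps). [cite: JamesKerber1981, 1.3.13] -/
theorem card_filter_injective_eq_factorial_mul_card (P : Finset X → Prop) [DecidablePred P] :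
    ((univ : Finset (Fin D → X)).filter
        fun f => Function.Injective f ∧ P (univ.image f)).card =
      D.factorial * ((univ : Finset (Finset X)).filter fun S => S.card = D ∧ P S).card := by
  classical
  rw [Finset.card_eq_sum_card_fiberwise (f := fun f : Fin D → X => univ.image f) (t := univ)
      (fun _ _ => mem_univ _), Finset.card_filter, Finset.mul_sum]
  refine Finset.sum_congr rfl fun S _ => ?_
  rw [Finset.filter_filter]
  by_cases hP : P S
  · have hset : (univ.filter fun f : Fin D → X =>
          (Function.Injective f ∧ P (univ.image f)) ∧ univ.image f = S) =
        univ.filter fun f : Fin D → X => Function.Injective f ∧ univ.image f = S := by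
      refine Finset.filter_congr fun f _ => ⟨fun h => ⟨h.1.1, h.2⟩, fun h => ⟨⟨h.1, ?_⟩, h.2⟩⟩
      rw [h.2]; exact hP
    rw [hset, card_filter_injective_image_eq]
    by_cases hS : S.card = D <;> simp [hS, hP]
  · have hset : (univ.filter fun f : Fin D → X =>
          (Function.Injective f ∧ P (univ.image f)) ∧ univ.image f = S) = ∅ := by
      refine Finset.filter_eq_empty_iff.mpr ?_
      rintro f - ⟨⟨-, hPf⟩, rfl⟩
      exact hP hPf
    rw [hset, card_empty]
    simp [hP]

end Injective

/-! ### 2. Binary arrays in the cube `[N]³` with shifted margins -/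

section Cube

variable {N D : ℕ}

/-- The **binary `N × N × N` arrays** (= subsets of the cube `[N]³`, points written `((x, y), z)`)
with `D` ones and slice margins `a + ρ - τ₁ρ`, `b + ρ - τ₂ρ`, `c + ρ - τ₃ρ` along the three axes,
in the additive form of the tree's Frobenius formula: `ρ(τ₁⁻¹ j) + #{s ∈ S : x(s) = j} = a_j + ρ_j`
etc. (`ρ = (N-1, …, 0)`). IMW's point sets `P ⊆ {0..r-1}³` with prescribed marginal distributions
(their `t^λ_{μπ}` is the case `τ = 1`). [cite: IkenmeyerMulmuleyWalter2017, Lemma 2.2 (arXiv p. 7)] -/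
def binaryCubes (N D : ℕ) (τ₁ τ₂ τ₃ : Equiv.Perm (Fin N)) (a b c : Fin N → ℕ) :
    Finset (Finset ((Fin N × Fin N) × Fin N)) :=
  univ.filter fun S => S.card = D ∧
    (∀ j, rho N (τ₁⁻¹ j) + (S.filter fun s => s.1.1 = j).card = a j + rho N j) ∧
    (∀ j, rho N (τ₂⁻¹ j) + (S.filter fun s => s.1.2 = j).card = b j + rho N j) ∧
    (∀ j, rho N (τ₃⁻¹ j) + (S.filter fun s => s.2 = j).card = c j + rho N j)

/-- The **signed count of binary arrays in the cube**:
`Σ_{τ₁,τ₂,τ₃ ∈ 𝔖_N} sgn τ₁ sgn τ₂ sgn τ₃ · #binaryCubes N D τ₁ τ₂ τ₃ a b c` — the alternant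
(Weyl-character) combination of IMW's weight multiplicities `t` of `Λ^D(ℂ^N ⊗ ℂ^N ⊗ ℂ^N)`.
[cite: IkenmeyerMulmuleyWalter2017, Lemma 2.1–2.2 (arXiv p. 7)] -/
def signedBinaryCubeCount (N D : ℕ) (a b c : Fin N → ℕ) : ℤ :=
  ∑ τ₁ : Equiv.Perm (Fin N), ∑ τ₂ : Equiv.Perm (Fin N), ∑ τ₃ : Equiv.Perm (Fin N),
    ((Equiv.Perm.sign τ₁ : ℤ) * (Equiv.Perm.sign τ₂ : ℤ) * (Equiv.Perm.sign τ₃ : ℤ)) *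
      ((binaryCubes N D τ₁ τ₂ τ₃ a b c).card : ℤ)

/-- Unfolding lemma for membership in `binaryCubes`. [cite: IkenmeyerMulmuleyWalter2017, Lemma 2.2 (arXiv p. 7)] -/
theorem mem_binaryCubes {τ₁ τ₂ τ₃ : Equiv.Perm (Fin N)} {a b c : Fin N → ℕ}
    {S : Finset ((Fin N × Fin N) × Fin N)} :
    S ∈ binaryCubes N D τ₁ τ₂ τ₃ a b c ↔ S.card = D ∧
      (∀ j, rho N (τ₁⁻¹ j) + (S.filter fun s => s.1.1 = j).card = a j + rho N j) ∧
      (∀ j, rho N (τ₂⁻¹ j) + (S.filter fun s => s.1.2 = j).card = b j + rho N j) ∧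
      (∀ j, rho N (τ₃⁻¹ j) + (S.filter fun s => s.2 = j).card = c j + rho N j) := by
  rw [binaryCubes, mem_filter]
  exact and_iff_right (mem_univ _)

/-- The content of a coordinate word of an injective map into the cube is the slice margin of its
image. [cite: IkenmeyerMulmuleyWalter2017, Lemma 2.2 (arXiv p. 7)] -/
theorem card_filter_eq_card_filter_image {Y : Type*} [DecidableEq Y]
    (f : Fin D → (Fin N × Fin N) × Fin N) (hf : Function.Injective f)
    (π : (Fin N × Fin N) × Fin N → Y) (y : Y) :
    (univ.filter fun p : Fin D => π (f p) = y).card =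
      ((univ.image f).filter fun s => π s = y).card := by
  rw [Finset.filter_image, Finset.card_image_of_injective _ hf]

/-- **Injective triples of words with prescribed shifted contents are `D!` times the binary
arrays**: `#{(u, v, w) : cont = (a, b, c) shifted by (τ₁, τ₂, τ₃), p ↦ (u p, v p, w p) injective}
= D! · #binaryCubes N D τ₁ τ₂ τ₃ a b c`. [cite: IkenmeyerMulmuleyWalter2017, Lemma 2.2 (arXiv p. 7)] -/
theorem card_injective_triples_eq_factorial_mul_card_binaryCubes (τ₁ τ₂ τ₃ : Equiv.Perm (Fin N))
    (a b c : Fin N → ℕ) :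
    (((univ.filter fun u : Word N D => ∀ j, rho N (τ₁⁻¹ j) + wordContent u j = a j + rho N j) ×ˢ
        (univ.filter fun v : Word N D => ∀ j, rho N (τ₂⁻¹ j) + wordContent v j = b j + rho N j) ×ˢ
        (univ.filter fun w : Word N D => ∀ j, rho N (τ₃⁻¹ j) + wordContent w j = c j + rho N j)).filter
        fun x => Function.Injective (fun p => ((x.1 p, x.2.1 p), x.2.2 p))).card =
      D.factorial * (binaryCubes N D τ₁ τ₂ τ₃ a b c).card := by
  classical
  -- the margins property of a subset of the cube
  let P : Finset ((Fin N × Fin N) × Fin N) → Prop := fun S =>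
    (∀ j, rho N (τ₁⁻¹ j) + (S.filter fun s => s.1.1 = j).card = a j + rho N j) ∧
    (∀ j, rho N (τ₂⁻¹ j) + (S.filter fun s => s.1.2 = j).card = b j + rho N j) ∧
    (∀ j, rho N (τ₃⁻¹ j) + (S.filter fun s => s.2 = j).card = c j + rho N j)
  have hcubes : binaryCubes N D τ₁ τ₂ τ₃ a b c =
      (univ : Finset (Finset ((Fin N × Fin N) × Fin N))).filter fun S => S.card = D ∧ P S := rfl
  rw [hcubes, ← card_filter_injective_eq_factorial_mul_card P]
  -- the zipping equivalence
  let e : (Word N D × Word N D × Word N D) ≃ (Fin D → (Fin N × Fin N) × Fin N) :=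
    { toFun := fun x p => ((x.1 p, x.2.1 p), x.2.2 p)
      invFun := fun f => (fun p => (f p).1.1, fun p => (f p).1.2, fun p => (f p).2)
      left_inv := fun _ => rfl
      right_inv := fun _ => rfl }
  refine Finset.card_equiv e fun x => ?_
  simp only [mem_filter, mem_product, mem_univ, true_and]
  constructor
  · rintro ⟨⟨ha, hb, hc⟩, hinj⟩
    refine ⟨hinj, fun j => ?_, fun j => ?_, fun j => ?_⟩
    · rw [← card_filter_eq_card_filter_image (e x) hinj (fun s => s.1.1) j]
      exact ha j
    · rw [← card_filter_eq_card_filter_image (e x) hinj (fun s => s.1.2) j]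
      exact hb j
    · rw [← card_filter_eq_card_filter_image (e x) hinj (fun s => s.2) j]
      exact hc j
  · rintro ⟨hinj, ha, hb, hc⟩
    refine ⟨⟨fun j => ?_, fun j => ?_, fun j => ?_⟩, hinj⟩
    · have := ha j
      rw [← card_filter_eq_card_filter_image (e x) hinj (fun s => s.1.1) j] at this
      exact this
    · have := hb j
      rw [← card_filter_eq_card_filter_image (e x) hinj (fun s => s.1.2) j] at this
      exact this
    · have := hc j
      rw [← card_filter_eq_card_filter_image (e x) hinj (fun s => s.2) j] at this
      exact this

end Cube

/-! ### 3. The Kronecker coefficient as a signed count of binary arrays -/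

section Kronecker

variable {N D : ℕ}

/-- Distributing a constant times a triple product of sums (plumbing). [folklore] -/
private theorem mul_sum_mul_sum_mul_sum {ι R : Type*} [CommRing R] [Fintype ι] (x : R)
    (f g h : ι → R) :
    x * (∑ i, f i) * (∑ j, g j) * (∑ l, h l) = ∑ i, ∑ j, ∑ l, x * (f i * g j * h l) := by
  have e1 : x * (∑ i, f i) * (∑ j, g j) * (∑ l, h l) =
      x * ((∑ i, f i) * ((∑ j, g j) * (∑ l, h l))) := by ring
  rw [e1, Finset.sum_mul_sum, Finset.sum_mul_sum, Finset.mul_sum]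
  refine Finset.sum_congr rfl fun i _ => ?_
  rw [Finset.mul_sum]
  refine Finset.sum_congr rfl fun j _ => ?_
  rw [Finset.mul_sum, Finset.mul_sum]
  refine Finset.sum_congr rfl fun l _ => ?_
  ring

/-- The shifted-content word family of Frobenius's formula, filtered by `σ`-invariance, is the
family appearing in `spechtCharacter_eq_sum_sign_mul_card`. [cite: FultonHarrisGTM129, §4.3 (4.41)] -/
theorem filter_fixed_filter_content_eq (τ : Equiv.Perm (Fin N)) (a : Fin N → ℕ)
    (σ : Equiv.Perm (Fin D)) :
    ((univ.filter fun w : Word N D => ∀ j, rho N (τ⁻¹ j) + wordContent w j = a j + rho N j).filter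
        fun w => w ∘ ⇑σ = w) =
      univ.filter fun w : Word N D => w ∘ ⇑σ = w ∧
        ∀ j, rho N (τ⁻¹ j) + wordContent w j = a j + rho N j := by
  rw [Finset.filter_filter]
  exact Finset.filter_congr fun w _ => and_comm

/-- **`D! · g(λ, μ, ν) = D! · (signed count of binary arrays)`** — the character formula, the sign
twist `χ^λ = sgn·χ^{λᵀ}`, Frobenius's formula for the three characters, the sign-weighted fixed-word
lemma and the `D!`-to-one passage from injective triples to subsets of the cube.
[cite: IkenmeyerMulmuleyWalter2017, Lemma 2.1–2.2 (arXiv p. 7)] -/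
theorem factorial_mul_kroneckerCoeff_eq_factorial_mul_signedBinaryCubeCount
    (lam μ ν : Nat.Partition D) (hlam : lam.transpose.parts.card ≤ N) (hμ : μ.parts.card ≤ N)
    (hν : ν.parts.card ≤ N) :
    ((D.factorial * kroneckerCoeff ℂ lam μ ν : ℕ) : ℤ) =
      (D.factorial : ℤ) * signedBinaryCubeCount N D (fun j => lam.transpose.sortedParts.getD j 0)
        (fun j => μ.sortedParts.getD j 0) (fun j => ν.sortedParts.getD j 0) := by
  classical
  -- abbreviations for the three margin vectors
  set a : Fin N → ℕ := fun j => lam.transpose.sortedParts.getD j 0 with ha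
  set b : Fin N → ℕ := fun j => μ.sortedParts.getD j 0 with hb
  set c : Fin N → ℕ := fun j => ν.sortedParts.getD j 0 with hc
  -- the three word families
  set A : Equiv.Perm (Fin N) → Finset (Word N D) := fun τ =>
    univ.filter fun w : Word N D => ∀ j, rho N (τ⁻¹ j) + wordContent w j = a j + rho N j with hA
  set B : Equiv.Perm (Fin N) → Finset (Word N D) := fun τ =>
    univ.filter fun w : Word N D => ∀ j, rho N (τ⁻¹ j) + wordContent w j = b j + rho N j with hB
  set C : Equiv.Perm (Fin N) → Finset (Word N D) := fun τ =>
    univ.filter fun w : Word N D => ∀ j, rho N (τ⁻¹ j) + wordContent w j = c j + rho N j with hC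
  -- work in `ℂ`
  have key : ((D.factorial * kroneckerCoeff ℂ lam μ ν : ℕ) : ℂ) =
      ((D.factorial : ℤ) * signedBinaryCubeCount N D a b c : ℤ) := by
    rw [kroneckerCoeff_eq_sum_spechtCharacter_holds ℂ lam μ ν]
    -- the three characters
    have h1 : ∀ σ : Equiv.Perm (Fin D), spechtCharacter ℂ lam σ =
        ((Equiv.Perm.sign σ : ℤ) : ℂ) * ∑ τ : Equiv.Perm (Fin N), ((Equiv.Perm.sign τ : ℤ) : ℂ) *
          (((A τ).filter fun w => w ∘ ⇑σ = w).card : ℂ) := by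
      intro σ
      have ht := spechtCharacter_transpose ℂ lam.transpose σ
      rw [Nat.Partition.transpose_transpose] at ht
      rw [ht, spechtCharacter_eq_sum_sign_mul_card lam.transpose hlam σ]
      congr 1
      refine Finset.sum_congr rfl fun τ _ => ?_
      rw [hA, filter_fixed_filter_content_eq]
    have h2 : ∀ σ : Equiv.Perm (Fin D), spechtCharacter ℂ μ σ =
        ∑ τ : Equiv.Perm (Fin N), ((Equiv.Perm.sign τ : ℤ) : ℂ) *
          (((B τ).filter fun w => w ∘ ⇑σ = w).card : ℂ) := by
      intro σ
      rw [spechtCharacter_eq_sum_sign_mul_card μ hμ σ]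
      refine Finset.sum_congr rfl fun τ _ => ?_
      rw [hB, filter_fixed_filter_content_eq]
    have h3 : ∀ σ : Equiv.Perm (Fin D), spechtCharacter ℂ ν σ =
        ∑ τ : Equiv.Perm (Fin N), ((Equiv.Perm.sign τ : ℤ) : ℂ) *
          (((C τ).filter fun w => w ∘ ⇑σ = w).card : ℂ) := by
      intro σ
      rw [spechtCharacter_eq_sum_sign_mul_card ν hν σ]
      refine Finset.sum_congr rfl fun τ _ => ?_
      rw [hC, filter_fixed_filter_content_eq]
    simp_rw [h1, h2, h3]
    -- expand the products of sums: for each `σ` a sum over `(τ₁, τ₂, τ₃)`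
    have hexp : ∀ σ : Equiv.Perm (Fin D),
        ((Equiv.Perm.sign σ : ℤ) : ℂ) * (∑ τ₁ : Equiv.Perm (Fin N), ((Equiv.Perm.sign τ₁ : ℤ) : ℂ) *
            (((A τ₁).filter fun w => w ∘ ⇑σ = w).card : ℂ)) *
          (∑ τ₂ : Equiv.Perm (Fin N), ((Equiv.Perm.sign τ₂ : ℤ) : ℂ) *
            (((B τ₂).filter fun w => w ∘ ⇑σ = w).card : ℂ)) *
          (∑ τ₃ : Equiv.Perm (Fin N), ((Equiv.Perm.sign τ₃ : ℤ) : ℂ) *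
            (((C τ₃).filter fun w => w ∘ ⇑σ = w).card : ℂ)) =
        ∑ τ₁ : Equiv.Perm (Fin N), ∑ τ₂ : Equiv.Perm (Fin N), ∑ τ₃ : Equiv.Perm (Fin N),
          (((Equiv.Perm.sign τ₁ : ℤ) : ℂ) * ((Equiv.Perm.sign τ₂ : ℤ) : ℂ) *
              ((Equiv.Perm.sign τ₃ : ℤ) : ℂ)) *
            (((Equiv.Perm.sign σ : ℤ) : ℂ) *
              ((((A τ₁).filter fun w => w ∘ ⇑σ = w).card *
                ((B τ₂).filter fun w => w ∘ ⇑σ = w).card *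
                ((C τ₃).filter fun w => w ∘ ⇑σ = w).card : ℕ) : ℂ)) := by
      intro σ
      rw [mul_sum_mul_sum_mul_sum]
      refine Finset.sum_congr rfl fun τ₁ _ => ?_
      refine Finset.sum_congr rfl fun τ₂ _ => ?_
      refine Finset.sum_congr rfl fun τ₃ _ => ?_
      push_cast
      ring
    simp_rw [hexp]
    -- bring the sum over `σ` inside
    rw [Finset.sum_comm]
    simp only [signedBinaryCubeCount, Finset.mul_sum, Int.cast_sum, Int.cast_mul, Int.cast_natCast]
    refine Finset.sum_congr rfl fun τ₁ _ => ?_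
    rw [Finset.sum_comm]
    refine Finset.sum_congr rfl fun τ₂ _ => ?_
    rw [Finset.sum_comm]
    refine Finset.sum_congr rfl fun τ₃ _ => ?_
    rw [← Finset.mul_sum]
    -- the sign-weighted fixed-word lemma and the passage to subsets
    have hP1 := sum_sign_mul_card_fixed_eq_card_injective (A τ₁) (B τ₂) (C τ₃)
    have hP1' : (∑ σ : Equiv.Perm (Fin D), ((Equiv.Perm.sign σ : ℤ) : ℂ) *
        ((((A τ₁).filter fun w => w ∘ ⇑σ = w).card *
          ((B τ₂).filter fun w => w ∘ ⇑σ = w).card *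
          ((C τ₃).filter fun w => w ∘ ⇑σ = w).card : ℕ) : ℂ)) =
        ((D.factorial * (binaryCubes N D τ₁ τ₂ τ₃ a b c).card : ℕ) : ℂ) := by
      rw [← card_injective_triples_eq_factorial_mul_card_binaryCubes τ₁ τ₂ τ₃ a b c]
      have := congrArg (fun z : ℤ => (z : ℂ)) hP1
      simpa only [Int.cast_sum, Int.cast_mul, Int.cast_natCast, hA, hB, hC] using this
    rw [hP1']
    push_cast
    ring
  exact_mod_cast key

/-- **Kronecker coefficients are signed counts of binary three-dimensional arrays**: for
`λ, μ, ν ⊢ D` with `ℓ(λᵀ), ℓ(μ), ℓ(ν) ≤ N`,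
`g(λ, μ, ν) = Σ_{τ₁,τ₂,τ₃ ∈ 𝔖_N} sgn τ₁ sgn τ₂ sgn τ₃ · #{S ⊆ [N]³ : #S = D, margins
λᵀ + ρ - τ₁ρ, μ + ρ - τ₂ρ, ν + ρ - τ₃ρ}` — the alternant form of IMW Lemma 2.1 + 2.2
(`k^λ_{μπ} = [Λ^D(ℂ^N⊗ℂ^N⊗ℂ^N) : V_{λᵀ} ⊗ V_{μᵀ} ⊗ V_{πᵀ}]`, weight multiplicities = point sets),
proved here on the symmetric-group side by Frobenius's formula.
[cite: IkenmeyerMulmuleyWalter2017, Lemma 2.1–2.2 (arXiv p. 7)] -/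
theorem kroneckerCoeff_eq_signedBinaryCubeCount (lam μ ν : Nat.Partition D)
    (hlam : lam.transpose.parts.card ≤ N) (hμ : μ.parts.card ≤ N) (hν : ν.parts.card ≤ N) :
    (kroneckerCoeff ℂ lam μ ν : ℤ) =
      signedBinaryCubeCount N D (fun j => lam.transpose.sortedParts.getD j 0)
        (fun j => μ.sortedParts.getD j 0) (fun j => ν.sortedParts.getD j 0) := by
  have h := factorial_mul_kroneckerCoeff_eq_factorial_mul_signedBinaryCubeCount lam μ ν hlam hμ hν
  rw [Nat.cast_mul] at h
  exact mul_left_cancel₀ (by exact_mod_cast D.factorial_ne_zero) h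

end Kronecker

/-! ### 4. Complementation in the cube (constant margins) -/

section Complement

variable {N : ℕ}

/-- A slice of the cube `[N]³` perpendicular to the first axis has `N²` points. [cite: IkenmeyerMulmuleyWalter2017, Lemma 2.2 (arXiv p. 7)] -/
theorem card_filter_fst_fst_eq (i : Fin N) :
    ((univ : Finset ((Fin N × Fin N) × Fin N)).filter fun s => s.1.1 = i).card = N * N := by
  have h : ((univ : Finset ((Fin N × Fin N) × Fin N)).filter fun s => s.1.1 = i) =
      (univ : Finset (Fin N × Fin N)).map
        ⟨fun q => ((i, q.1), q.2), fun q q' h => by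
          simp only [Prod.mk.injEq, true_and] at h; exact Prod.ext h.1 h.2⟩ := by
    ext s
    simp only [mem_filter, mem_univ, true_and, mem_map, Function.Embedding.coeFn_mk]
    constructor
    · intro hs; exact ⟨(s.1.2, s.2), by rw [← hs]⟩
    · rintro ⟨q, rfl⟩; rfl
  rw [h, card_map, card_univ, Fintype.card_prod, Fintype.card_fin]

/-- A slice of the cube `[N]³` perpendicular to the second axis has `N²` points. [cite: IkenmeyerMulmuleyWalter2017, Lemma 2.2 (arXiv p. 7)] -/
theorem card_filter_fst_snd_eq (i : Fin N) :
    ((univ : Finset ((Fin N × Fin N) × Fin N)).filter fun s => s.1.2 = i).card = N * N := by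
  have h : ((univ : Finset ((Fin N × Fin N) × Fin N)).filter fun s => s.1.2 = i) =
      (univ : Finset (Fin N × Fin N)).map
        ⟨fun q => ((q.1, i), q.2), fun q q' h => by
          simp only [Prod.mk.injEq, and_true] at h; exact Prod.ext h.1 h.2⟩ := by
    ext s
    simp only [mem_filter, mem_univ, true_and, mem_map, Function.Embedding.coeFn_mk]
    constructor
    · intro hs; exact ⟨(s.1.1, s.2), by rw [← hs]⟩
    · rintro ⟨q, rfl⟩; rfl
  rw [h, card_map, card_univ, Fintype.card_prod, Fintype.card_fin]

/-- A slice of the cube `[N]³` perpendicular to the third axis has `N²` points. [cite: IkenmeyerMulmuleyWalter2017, Lemma 2.2 (arXiv p. 7)] -/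
theorem card_filter_snd_eq (i : Fin N) :
    ((univ : Finset ((Fin N × Fin N) × Fin N)).filter fun s => s.2 = i).card = N * N := by
  have h : ((univ : Finset ((Fin N × Fin N) × Fin N)).filter fun s => s.2 = i) =
      (univ : Finset (Fin N × Fin N)).map
        ⟨fun q => (q, i), fun q q' h => by
          simp only [Prod.mk.injEq, and_true] at h; exact h⟩ := by
    ext s
    simp only [mem_filter, mem_univ, true_and, mem_map, Function.Embedding.coeFn_mk]
    constructor
    · intro hs; exact ⟨s.1, by rw [← hs]⟩
    · rintro ⟨q, rfl⟩; rfl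
  rw [h, card_map, card_univ, Fintype.card_prod, Fintype.card_fin]

/-- Slice margins of a set and of its complement add up to `N²`. [cite: IkenmeyerMulmuleyWalter2017, Lemma 2.2 (arXiv p. 7)] -/
theorem card_filter_compl_add {Y : Type*} [DecidableEq Y] (S : Finset ((Fin N × Fin N) × Fin N))
    (π : (Fin N × Fin N) × Fin N → Y) (y : Y) :
    (Sᶜ.filter fun s => π s = y).card + (S.filter fun s => π s = y).card =
      ((univ : Finset ((Fin N × Fin N) × Fin N)).filter fun s => π s = y).card := by
  rw [← card_union_of_disjoint (disjoint_filter_filter disjoint_compl_left), ← filter_union,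
    union_comm, Finset.union_compl]

/-- The axis relabelling `((x, y), z) ↦ ((τ₁⁻¹ x, τ₂⁻¹ y), τ₃⁻¹ z)` of the cube, as an embedding.
[cite: IkenmeyerMulmuleyWalter2017, Lemma 2.2 (arXiv p. 7)] -/
def cubeRelabel (τ₁ τ₂ τ₃ : Equiv.Perm (Fin N)) :
    ((Fin N × Fin N) × Fin N) ↪ ((Fin N × Fin N) × Fin N) :=
  ((τ₁⁻¹.prodCongr τ₂⁻¹).prodCongr τ₃⁻¹).toEmbedding

/-- Pointwise formula for `cubeRelabel`. [cite: IkenmeyerMulmuleyWalter2017, Lemma 2.2 (arXiv p. 7)] -/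
@[simp] theorem cubeRelabel_apply (τ₁ τ₂ τ₃ : Equiv.Perm (Fin N)) (s : (Fin N × Fin N) × Fin N) :
    cubeRelabel τ₁ τ₂ τ₃ s = ((τ₁⁻¹ s.1.1, τ₂⁻¹ s.1.2), τ₃⁻¹ s.2) := rfl

/-- **Complementation maps binary arrays with constant margin `m` (`D = mN` ones, shifts `τᵢ`)
injectively to binary arrays with constant margin `m'` (`D' = m'N` ones, shifts `τᵢ⁻¹`)** whenever
`m + m' = N²`: `S ↦` the relabelled complement `{((τ₁⁻¹x, τ₂⁻¹y), τ₃⁻¹z) : ((x,y),z) ∉ S}`.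
[cite: IkenmeyerMulmuleyWalter2017, Lemma 2.2 (arXiv p. 7)] -/
theorem card_binaryCubes_const_le_of_add_eq_sq {m m' : ℕ} (h : m + m' = N * N)
    (τ₁ τ₂ τ₃ : Equiv.Perm (Fin N)) :
    (binaryCubes N (m * N) τ₁ τ₂ τ₃ (fun _ => m) (fun _ => m) (fun _ => m)).card ≤
      (binaryCubes N (m' * N) τ₁⁻¹ τ₂⁻¹ τ₃⁻¹ (fun _ => m') (fun _ => m') (fun _ => m')).card := by
  classical
  refine Finset.card_le_card_of_injOn (fun S => Sᶜ.map (cubeRelabel τ₁ τ₂ τ₃)) (fun S hS => ?_)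
    (fun S _ T _ hST => ?_)
  · rw [Finset.mem_coe, mem_binaryCubes] at hS ⊢
    obtain ⟨hcard, h1, h2, h3⟩ := hS
    have hcube : Fintype.card ((Fin N × Fin N) × Fin N) = N * N * N := by
      simp only [Fintype.card_prod, Fintype.card_fin]
    refine ⟨?_, fun j => ?_, fun j => ?_, fun j => ?_⟩
    · rw [card_map, Finset.card_compl, hcard, hcube, ← h]
      rw [Nat.add_mul, Nat.add_sub_cancel_left]
    · -- first axis
      have hmap : ((Sᶜ.map (cubeRelabel τ₁ τ₂ τ₃)).filter fun s => s.1.1 = j).card =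
          (Sᶜ.filter fun s => s.1.1 = τ₁ j).card := by
        rw [Finset.filter_map, card_map]
        congr 1
        refine Finset.filter_congr fun s _ => ?_
        simp only [Function.comp_apply, cubeRelabel_apply]
        exact Equiv.Perm.inv_eq_iff_eq
      have hsum := card_filter_compl_add S (fun s => s.1.1) (τ₁ j)
      rw [card_filter_fst_fst_eq] at hsum
      have hj := h1 (τ₁ j)
      simp only [Equiv.Perm.coe_inv, Equiv.symm_apply_apply] at hj
      rw [inv_inv, hmap]
      omega
    · -- second axis
      have hmap : ((Sᶜ.map (cubeRelabel τ₁ τ₂ τ₃)).filter fun s => s.1.2 = j).card =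
          (Sᶜ.filter fun s => s.1.2 = τ₂ j).card := by
        rw [Finset.filter_map, card_map]
        congr 1
        refine Finset.filter_congr fun s _ => ?_
        simp only [Function.comp_apply, cubeRelabel_apply]
        exact Equiv.Perm.inv_eq_iff_eq
      have hsum := card_filter_compl_add S (fun s => s.1.2) (τ₂ j)
      rw [card_filter_fst_snd_eq] at hsum
      have hj := h2 (τ₂ j)
      simp only [Equiv.Perm.coe_inv, Equiv.symm_apply_apply] at hj
      rw [inv_inv, hmap]
      omega
    · -- third axis
      have hmap : ((Sᶜ.map (cubeRelabel τ₁ τ₂ τ₃)).filter fun s => s.2 = j).card =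
          (Sᶜ.filter fun s => s.2 = τ₃ j).card := by
        rw [Finset.filter_map, card_map]
        congr 1
        refine Finset.filter_congr fun s _ => ?_
        simp only [Function.comp_apply, cubeRelabel_apply]
        exact Equiv.Perm.inv_eq_iff_eq
      have hsum := card_filter_compl_add S (fun s => s.2) (τ₃ j)
      rw [card_filter_snd_eq] at hsum
      have hj := h3 (τ₃ j)
      simp only [Equiv.Perm.coe_inv, Equiv.symm_apply_apply] at hj
      rw [inv_inv, hmap]
      omega
  · have hST' : Sᶜ = Tᶜ := Finset.map_injective _ hST
    exact compl_injective hST'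

/-- **Complementation is a bijection** between the binary arrays at `(τ; m; mN)` and at
`(τ⁻¹; m'; m'N)`, `m + m' = N²`. [cite: IkenmeyerMulmuleyWalter2017, Lemma 2.2 (arXiv p. 7)] -/
theorem card_binaryCubes_const_eq_of_add_eq_sq {m m' : ℕ} (h : m + m' = N * N)
    (τ₁ τ₂ τ₃ : Equiv.Perm (Fin N)) :
    (binaryCubes N (m * N) τ₁ τ₂ τ₃ (fun _ => m) (fun _ => m) (fun _ => m)).card =
      (binaryCubes N (m' * N) τ₁⁻¹ τ₂⁻¹ τ₃⁻¹ (fun _ => m') (fun _ => m') (fun _ => m')).card := by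
  refine le_antisymm (card_binaryCubes_const_le_of_add_eq_sq h τ₁ τ₂ τ₃) ?_
  have h' : m' + m = N * N := by rw [add_comm, h]
  have := card_binaryCubes_const_le_of_add_eq_sq h' τ₁⁻¹ τ₂⁻¹ τ₃⁻¹
  simpa only [inv_inv] using this

/-- **Complement symmetry of the signed count for constant margins**: for `m + m' = N²`,
`signedBinaryCubeCount N (mN) m m m = signedBinaryCubeCount N (m'N) m' m' m'` (complement the
array, relabel the axes by `τᵢ`, reindex the alternant by `τ ↦ τ⁻¹`, `sgn τ⁻¹ = sgn τ`) — the
combinatorial form of `Λ^D(W) ≅ Λ^{N³-D}(W)^* ⊗ det W`, `W = ℂ^N ⊗ ℂ^N ⊗ ℂ^N`.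
[cite: IkenmeyerMulmuleyWalter2017, Lemma 2.1–2.2 (arXiv p. 7)] -/
theorem signedBinaryCubeCount_const_eq_of_add_eq_sq {m m' : ℕ} (h : m + m' = N * N) :
    signedBinaryCubeCount N (m * N) (fun _ => m) (fun _ => m) (fun _ => m) =
      signedBinaryCubeCount N (m' * N) (fun _ => m') (fun _ => m') (fun _ => m') := by
  unfold signedBinaryCubeCount
  rw [← Equiv.sum_comp (Equiv.inv (Equiv.Perm (Fin N)))]
  refine Finset.sum_congr rfl fun τ₁ _ => ?_
  rw [← Equiv.sum_comp (Equiv.inv (Equiv.Perm (Fin N)))]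
  refine Finset.sum_congr rfl fun τ₂ _ => ?_
  rw [← Equiv.sum_comp (Equiv.inv (Equiv.Perm (Fin N)))]
  refine Finset.sum_congr rfl fun τ₃ _ => ?_
  simp only [Equiv.inv_apply, Equiv.Perm.sign_inv]
  rw [card_binaryCubes_const_eq_of_add_eq_sq h τ₁⁻¹ τ₂⁻¹ τ₃⁻¹, inv_inv, inv_inv, inv_inv]

end Complement

/-! ### 5. Complementation for general margins: the box complement (reversal of the three axes) -/

section BoxComplement

variable {N : ℕ}

/-- `w₀⁻¹ = w₀` for the order-reversing permutation `w₀ = Fin.revPerm` (plumbing). [folklore] -/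
private theorem revPerm_inv : (Fin.revPerm : Equiv.Perm (Fin N))⁻¹ = Fin.revPerm := by
  rw [Equiv.Perm.inv_def, Fin.revPerm_symm]

/-- `ρ(w₀ x) = x` (plumbing: `ρ_j = N - 1 - j`). [folklore] -/
private theorem rho_rev (x : Fin N) : rho N (Fin.rev x) = x := by
  rw [rho_apply, Fin.val_rev]
  have := x.2
  omega

/-- Conjugation by `w₀` commutes with inversion (plumbing). [folklore] -/
private theorem conj_revPerm_inv (τ : Equiv.Perm (Fin N)) :
    (Fin.revPerm * τ * Fin.revPerm)⁻¹ = Fin.revPerm * τ⁻¹ * Fin.revPerm := by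
  rw [mul_inv_rev, mul_inv_rev, revPerm_inv, mul_assoc]

/-- **Box complementation maps binary arrays injectively**: for margins with
`a_j + a'_{w₀ j} = N²` (all three axes) and `D + D' = N³`, `S ↦` the complement of `S` with all three
axes reversed sends the arrays counted at `(τ₁, τ₂, τ₃; a, b, c; D)` into those counted at
`(w₀τ₁w₀, w₀τ₂w₀, w₀τ₃w₀; a', b', c'; D')`. With `a = λᵀ` this is the complement `n² × n - λ` of a
partition in the box (Bürgisser–Ikenmeyer 2017, proof of Thm. 5.9 (3), quoting Ikenmeyer's thesis:
`k(λ,μ,ν) = k(n²×n - λ, n²×n - μ, n²×n - ν)`). [cite: BurgisserIkenmeyer2017, Thm. 5.9 (3) (proof, arXiv p. 19)] -/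
theorem card_binaryCubes_le_compl_rev {D D' : ℕ} (hD : D + D' = N * N * N)
    {a b c a' b' c' : Fin N → ℕ} (ha : ∀ j, a j + a' (Fin.rev j) = N * N)
    (hb : ∀ j, b j + b' (Fin.rev j) = N * N) (hc : ∀ j, c j + c' (Fin.rev j) = N * N)
    (τ₁ τ₂ τ₃ : Equiv.Perm (Fin N)) :
    (binaryCubes N D τ₁ τ₂ τ₃ a b c).card ≤
      (binaryCubes N D' (Fin.revPerm * τ₁ * Fin.revPerm) (Fin.revPerm * τ₂ * Fin.revPerm)
        (Fin.revPerm * τ₃ * Fin.revPerm) a' b' c').card := by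
  classical
  refine Finset.card_le_card_of_injOn
    (fun S => Sᶜ.map (cubeRelabel Fin.revPerm Fin.revPerm Fin.revPerm)) (fun S hS => ?_)
    (fun S _ T _ hST => ?_)
  · rw [Finset.mem_coe, mem_binaryCubes] at hS ⊢
    obtain ⟨hcard, h1, h2, h3⟩ := hS
    have hcube : Fintype.card ((Fin N × Fin N) × Fin N) = N * N * N := by
      simp only [Fintype.card_prod, Fintype.card_fin]
    refine ⟨?_, fun j => ?_, fun j => ?_, fun j => ?_⟩
    · rw [card_map, Finset.card_compl, hcard, hcube]
      omega
    · -- first axis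
      have hmap : ((Sᶜ.map (cubeRelabel Fin.revPerm Fin.revPerm Fin.revPerm)).filter
          fun s => s.1.1 = j).card = (Sᶜ.filter fun s => s.1.1 = Fin.rev j).card := by
        rw [Finset.filter_map, card_map]
        congr 1
        refine Finset.filter_congr fun s _ => ?_
        simp only [Function.comp_apply, cubeRelabel_apply, revPerm_inv, Fin.revPerm_apply]
        exact Fin.rev_eq_iff
      have hsum := card_filter_compl_add S (fun s => s.1.1) (Fin.rev j)
      rw [card_filter_fst_fst_eq] at hsum
      have hj := h1 (Fin.rev j)
      rw [rho_rev] at hj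
      have haj := ha (Fin.rev j)
      rw [Fin.rev_rev] at haj
      rw [conj_revPerm_inv, hmap, Equiv.Perm.mul_apply, Equiv.Perm.mul_apply, Fin.revPerm_apply,
        Fin.revPerm_apply, rho_rev]
      have hρ : rho N (τ₁⁻¹ (Fin.rev j)) + ((τ₁⁻¹ (Fin.rev j) : Fin N) : ℕ) + 1 = N := by
        rw [rho_apply]; have := (τ₁⁻¹ (Fin.rev j)).2; omega
      have hρj : rho N j + (j : ℕ) + 1 = N := by
        rw [rho_apply]; have := j.2; omega
      omega
    · -- second axis
      have hmap : ((Sᶜ.map (cubeRelabel Fin.revPerm Fin.revPerm Fin.revPerm)).filter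
          fun s => s.1.2 = j).card = (Sᶜ.filter fun s => s.1.2 = Fin.rev j).card := by
        rw [Finset.filter_map, card_map]
        congr 1
        refine Finset.filter_congr fun s _ => ?_
        simp only [Function.comp_apply, cubeRelabel_apply, revPerm_inv, Fin.revPerm_apply]
        exact Fin.rev_eq_iff
      have hsum := card_filter_compl_add S (fun s => s.1.2) (Fin.rev j)
      rw [card_filter_fst_snd_eq] at hsum
      have hj := h2 (Fin.rev j)
      rw [rho_rev] at hj
      have hbj := hb (Fin.rev j)
      rw [Fin.rev_rev] at hbj
      rw [conj_revPerm_inv, hmap, Equiv.Perm.mul_apply, Equiv.Perm.mul_apply, Fin.revPerm_apply,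
        Fin.revPerm_apply, rho_rev]
      have hρ : rho N (τ₂⁻¹ (Fin.rev j)) + ((τ₂⁻¹ (Fin.rev j) : Fin N) : ℕ) + 1 = N := by
        rw [rho_apply]; have := (τ₂⁻¹ (Fin.rev j)).2; omega
      have hρj : rho N j + (j : ℕ) + 1 = N := by
        rw [rho_apply]; have := j.2; omega
      omega
    · -- third axis
      have hmap : ((Sᶜ.map (cubeRelabel Fin.revPerm Fin.revPerm Fin.revPerm)).filter
          fun s => s.2 = j).card = (Sᶜ.filter fun s => s.2 = Fin.rev j).card := by
        rw [Finset.filter_map, card_map]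
        congr 1
        refine Finset.filter_congr fun s _ => ?_
        simp only [Function.comp_apply, cubeRelabel_apply, revPerm_inv, Fin.revPerm_apply]
        exact Fin.rev_eq_iff
      have hsum := card_filter_compl_add S (fun s => s.2) (Fin.rev j)
      rw [card_filter_snd_eq] at hsum
      have hj := h3 (Fin.rev j)
      rw [rho_rev] at hj
      have hcj := hc (Fin.rev j)
      rw [Fin.rev_rev] at hcj
      rw [conj_revPerm_inv, hmap, Equiv.Perm.mul_apply, Equiv.Perm.mul_apply, Fin.revPerm_apply,
        Fin.revPerm_apply, rho_rev]
      have hρ : rho N (τ₃⁻¹ (Fin.rev j)) + ((τ₃⁻¹ (Fin.rev j) : Fin N) : ℕ) + 1 = N := by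
        rw [rho_apply]; have := (τ₃⁻¹ (Fin.rev j)).2; omega
      have hρj : rho N j + (j : ℕ) + 1 = N := by
        rw [rho_apply]; have := j.2; omega
      omega
  · have hST' : Sᶜ = Tᶜ := Finset.map_injective _ hST
    exact compl_injective hST'

/-- **Box complementation is a bijection** between the arrays at `(τ; a, b, c; D)` and at
`(w₀τw₀; a', b', c'; D')`, for complementary margins `a_j + a'_{w₀j} = N²` and `D + D' = N³`.
[cite: BurgisserIkenmeyer2017, Thm. 5.9 (3) (proof, arXiv p. 19)] -/
theorem card_binaryCubes_eq_compl_rev {D D' : ℕ} (hD : D + D' = N * N * N)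
    {a b c a' b' c' : Fin N → ℕ} (ha : ∀ j, a j + a' (Fin.rev j) = N * N)
    (hb : ∀ j, b j + b' (Fin.rev j) = N * N) (hc : ∀ j, c j + c' (Fin.rev j) = N * N)
    (τ₁ τ₂ τ₃ : Equiv.Perm (Fin N)) :
    (binaryCubes N D τ₁ τ₂ τ₃ a b c).card =
      (binaryCubes N D' (Fin.revPerm * τ₁ * Fin.revPerm) (Fin.revPerm * τ₂ * Fin.revPerm)
        (Fin.revPerm * τ₃ * Fin.revPerm) a' b' c').card := by
  refine le_antisymm (card_binaryCubes_le_compl_rev hD ha hb hc τ₁ τ₂ τ₃) ?_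
  have hD' : D' + D = N * N * N := by rw [add_comm, hD]
  have ha' : ∀ j, a' j + a (Fin.rev j) = N * N := fun j => by
    have := ha (Fin.rev j); rw [Fin.rev_rev] at this; omega
  have hb' : ∀ j, b' j + b (Fin.rev j) = N * N := fun j => by
    have := hb (Fin.rev j); rw [Fin.rev_rev] at this; omega
  have hc' : ∀ j, c' j + c (Fin.rev j) = N * N := fun j => by
    have := hc (Fin.rev j); rw [Fin.rev_rev] at this; omega
  have key := card_binaryCubes_le_compl_rev hD' ha' hb' hc' (Fin.revPerm * τ₁ * Fin.revPerm)
    (Fin.revPerm * τ₂ * Fin.revPerm) (Fin.revPerm * τ₃ * Fin.revPerm)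
  have hconj : ∀ τ : Equiv.Perm (Fin N),
      Fin.revPerm * (Fin.revPerm * τ * Fin.revPerm) * Fin.revPerm = τ := by
    intro τ
    have h2 : (Fin.revPerm : Equiv.Perm (Fin N)) * Fin.revPerm = 1 :=
      Equiv.ext fun x => by simp [Fin.rev_rev]
    calc Fin.revPerm * (Fin.revPerm * τ * Fin.revPerm) * Fin.revPerm
        = (Fin.revPerm * Fin.revPerm) * τ * (Fin.revPerm * Fin.revPerm) := by group
      _ = τ := by rw [h2, one_mul, mul_one]
  simpa only [hconj] using key

/-- The sign is invariant under conjugation by `w₀` (plumbing). [folklore] -/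
private theorem sign_conj_revPerm (τ : Equiv.Perm (Fin N)) :
    (Equiv.Perm.sign (Fin.revPerm * τ * Fin.revPerm) : ℤ) = (Equiv.Perm.sign τ : ℤ) := by
  rw [Equiv.Perm.sign_mul, Equiv.Perm.sign_mul, Units.val_mul, Units.val_mul]
  rcases Int.units_eq_one_or (Equiv.Perm.sign (Fin.revPerm : Equiv.Perm (Fin N))) with h | h <;>
    simp [h]

/-- **The box-complement symmetry of the signed count** (general margins): for complementary
margins `a_j + a'_{w₀j} = b_j + b'_{w₀j} = c_j + c'_{w₀j} = N²` and `D + D' = N³`,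
`signedBinaryCubeCount N D a b c = signedBinaryCubeCount N D' a' b' c'` — complement the array,
reverse the three axes, reindex the alternant by `τ ↦ w₀τw₀`. With `kroneckerCoeff_eq_signedBinaryCubeCount`
this is the partition box-complement relation `k(λ,μ,ν) = k(n²×n - λ, n²×n - μ, n²×n - ν)` of
Ikenmeyer's thesis quoted in Bürgisser–Ikenmeyer 2017 (column lengths `λᵀ_j + (n²×n - λ)ᵀ_{n-1-j} =
n²`); representation-theoretically `Λ^D(W) ≅ Λ^{N³-D}(W)^* ⊗ det W`. In print for rectangles:
Li–Zhang–Xia 2021 Thm. 3.1 / eq. (3.1), Amanov–Yeliussizov 2022 Thm. 5.1 (ii).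
[cite: BurgisserIkenmeyer2017, Thm. 5.9 (3) (proof, arXiv p. 19)] [cite: LiZhangXia2021, Thm. 3.1] -/
theorem signedBinaryCubeCount_eq_compl_rev {D D' : ℕ} (hD : D + D' = N * N * N)
    {a b c a' b' c' : Fin N → ℕ} (ha : ∀ j, a j + a' (Fin.rev j) = N * N)
    (hb : ∀ j, b j + b' (Fin.rev j) = N * N) (hc : ∀ j, c j + c' (Fin.rev j) = N * N) :
    signedBinaryCubeCount N D a b c = signedBinaryCubeCount N D' a' b' c' := by
  -- the conjugation bijection `τ ↦ w₀ τ w₀` of `𝔖_N`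
  set e : Equiv.Perm (Fin N) ≃ Equiv.Perm (Fin N) :=
    (Equiv.mulLeft (Fin.revPerm : Equiv.Perm (Fin N))).trans (Equiv.mulRight Fin.revPerm) with he
  have he' : ∀ τ, e τ = Fin.revPerm * τ * Fin.revPerm := fun τ => rfl
  unfold signedBinaryCubeCount
  symm
  rw [← Equiv.sum_comp e]
  refine Finset.sum_congr rfl fun τ₁ _ => ?_
  rw [← Equiv.sum_comp e]
  refine Finset.sum_congr rfl fun τ₂ _ => ?_
  rw [← Equiv.sum_comp e]
  refine Finset.sum_congr rfl fun τ₃ _ => ?_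
  rw [he', he', he', sign_conj_revPerm, sign_conj_revPerm, sign_conj_revPerm,
    ← card_binaryCubes_eq_compl_rev hD ha hb hc τ₁ τ₂ τ₃]

end BoxComplement

end Literature.RepresentationTheory.FiniteGroups
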